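import Summits.CriticalPhenomena.PercolationContinuityZ3.Theorems.PercNearOneGluingAdditiveGluingFingersThreeRelays
import HarnessLib

/-! # Crux `PercNearOneGluing.AdditiveGluing` (stmt-CriticalPhenomena-4576) — what the finger class REALLY needs: the block T-inequality
# (seat (b) V⁺-form, depth prover `png-dp-vplus`)

Support file (`--supports stmt-CriticalPhenomena-4576`); no definitions, no named facts.

The landed reduction `additiveGluing_fingers_of_FML3_at` derives `AdditiveGluing` for finger observers from the finger multi-edge Lemma 3
(registered stub `stub_fingerML3_vp`: `μ_{K/N}(R ∩ {d↔b}) ≤ μ_{K/N}(R ∩ ⋃_{v∈N}{v↔b})`).  Its proof only uses the WEAKER per-block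
T-inequality
  `μ_{K/N}(d ↔ b) ≤ μ_{K/N}(⋃_{v∈N} v ↔ b) + μ_{K/N}(block ↮ A)`,
i.e. `V'(K) ≥ −Ψ·(1 − μ_q(d↔b))` with `Ψ = P(no finger touches a relay)`, instead of `V'(K) ≥ 0` (FML3); the slack `Ψ(1 − μ_q(d↔b))` is
exactly Kozma–Nitzan's correction term `Σ_W P(C(0)=W)·…` for the layer `W = {o} ∪ N` (their Theorems 4–5 with the cruder bound `min_a ≤ 1`).
This file records that reduction (`additiveGluing_fingers_of_T_at`), so that a planner may restate the finger stub in its sharp form.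
[cite: KozmaNitzan2024, Thms 4–5 (pp. 13–14), Lemma 5 (p. 13), Question 9 (p. 36)]
-/

namespace Summit.CriticalPhenomena.PercolationContinuityZ3.Theorems

open MeasureTheory Set
open Literature.Probability.LatticeModels (prodBernoulli)
open Literature.Probability.Percolation (BondConfig openConn openGraph)
open scoped BigOperators Classical

noncomputable section

section FingersT

open Literature.Probability.Percolation

variable {n : ℕ}

/-- **`AdditiveGluing` for finger observers from the block T-inequality.**  `b ∈ A`, `o ∉ A`, finger observer (`hfing`).  If for every
weighting `K`, every non-empty finger block `N` disjoint from `A` (fingers free off `A`) and every `d ∈ A` minimising `μ_K(· ↔ b)` over `A`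
the glued block satisfies `0 ≤ μ_{K/N}((⋃_{v∈N}⋃_{a∈A} v↔a)ᶜ) + μ_{K/N}(⋃_{v∈N} v↔b) − μ_{K/N}(d↔b)` (hypothesis `hT`; implied by FML3 via
`T_finger_nonneg_of_X1`, and weaker than it by the slack `μ_{K/N}(block ↮ A)·(1 − μ_q(d↔b))`), then for every `t ≥ 0` with
`μ_w(a↔b) ≥ 1 − t` on `A`: `μ_w(o ↔ A) − t ≤ μ_w(o ↔ b)`. [cite: KozmaNitzan2024, Thms 4–5 (pp. 13–14), Question 9 (p. 36)] -/
theorem additiveGluing_fingers_of_T_at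
    (w : Sym2 (Fin n) → unitInterval) (A : Finset (Fin n)) (o b : Fin n) (hb : b ∈ A) (ho : o ∉ A)
    (hT : ∀ (K : Sym2 (Fin n) → unitInterval) (N : Finset (Fin n)) (d : Fin n),
      Disjoint N A → N.Nonempty → d ∈ A →
      (∀ v ∈ N, ∀ y : Fin n, y ∉ A → y ∉ N → (K s(v, y) : ℝ) = 0) →
      (∀ a ∈ A, (prodBernoulli K).real (openConn d b) ≤ (prodBernoulli K).real (openConn a b)) →
      0 ≤ (prodBernoulli (fun e' : Sym2 (Fin n) => if (∀ y ∈ e', y ∈ N) ∧ ¬ e'.IsDiag then 1 else K e')).real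
            (⋃ v ∈ N, ⋃ a ∈ A, openConn v a)ᶜ +
          (prodBernoulli (fun e' : Sym2 (Fin n) => if (∀ y ∈ e', y ∈ N) ∧ ¬ e'.IsDiag then 1 else K e')).real
            (⋃ v ∈ N, openConn v b) -
          (prodBernoulli (fun e' : Sym2 (Fin n) => if (∀ y ∈ e', y ∈ N) ∧ ¬ e'.IsDiag then 1 else K e')).real
            (openConn d b))
    (hfing : ∀ x : Fin n, x ∉ A → x ≠ o → (w s(o, x) : ℝ) ≠ 0 →
      ∀ y : Fin n, y ∉ A → y ≠ o → y ≠ x → (w s(x, y) : ℝ) = 0) :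
    ∀ t : ℝ, 0 ≤ t →
      (∀ a ∈ A, 1 - t ≤ (prodBernoulli w).real (openConn a b)) →
      (prodBernoulli w).real (⋃ a ∈ A, openConn o a) - t ≤ (prodBernoulli w).real (openConn o b) := by
  intro t _ hA
  have hSA : Disjoint ({o} : Finset (Fin n)) A := Finset.disjoint_singleton_left.2 ho
  -- Question-9 designation of `o`: a minimiser of the star-killed two-point function
  obtain ⟨e, he, hmin⟩ := Finset.exists_min_image A
    (fun a => (prodBernoulli (fun e' : Sym2 (Fin n) =>
      if (∃ y ∈ e', y ∈ ({o} : Finset (Fin n))) then (0 : unitInterval) else w e')).real (openConn a b)) ⟨b, hb⟩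
  have hcert := T_block_certificate w A {o} e b hb hSA he hmin
  -- the free layers of positive mass are finger blocks, on which FML3 gives a non-negative bracket
  have hsum : 0 ≤ ∑ N ∈ (Finset.univ : Finset (Finset (Fin n))).filter (fun N => N.Nonempty ∧ Disjoint N A),
      (prodBernoulli (fun e' : Sym2 (Fin n) =>
          if (∀ y ∈ e', y ∈ ({o} : Finset (Fin n))) ∧ ¬ e'.IsDiag then 1 else w e')).real
          {ω : BondConfig (Fin n) | ∀ y : Fin n, y ∈ N ↔ (y ∉ ({o} : Finset (Fin n)) ∧
            ∃ o' ∈ ({o} : Finset (Fin n)), s(o', y) ∈ ω)} *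
        ((prodBernoulli (fun e' : Sym2 (Fin n) =>
            if (∀ y ∈ e', y ∈ N) ∧ ¬ e'.IsDiag then 1 else
              if (∃ y ∈ e', y ∈ ({o} : Finset (Fin n))) then 0 else w e')).real
            (⋃ v ∈ N, ⋃ a ∈ A, openConn v a)ᶜ +
          (prodBernoulli (fun e' : Sym2 (Fin n) =>
            if (∀ y ∈ e', y ∈ N) ∧ ¬ e'.IsDiag then 1 else
              if (∃ y ∈ e', y ∈ ({o} : Finset (Fin n))) then 0 else w e')).real
            (⋃ v ∈ N, openConn v b) -
          (prodBernoulli (fun e' : Sym2 (Fin n) =>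
            if (∀ y ∈ e', y ∈ N) ∧ ¬ e'.IsDiag then 1 else
              if (∃ y ∈ e', y ∈ ({o} : Finset (Fin n))) then 0 else w e')).real
            (openConn e b)) := by
    refine Finset.sum_nonneg fun N hN => ?_
    obtain ⟨hNne, hNA⟩ := (Finset.mem_filter.1 hN).2
    by_cases hbad : ∃ y ∈ N, y = o ∨ (w s(o, y) : ℝ) = 0
    · -- a layer containing `o` itself or a non-neighbour of `o` has mass `0`
      obtain ⟨y, hyN, hy⟩ := hbad
      have hw0 : (prodBernoulli (fun e' : Sym2 (Fin n) =>
          if (∀ y ∈ e', y ∈ ({o} : Finset (Fin n))) ∧ ¬ e'.IsDiag then 1 else w e')).real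
          {ω : BondConfig (Fin n) | ∀ y : Fin n, y ∈ N ↔ (y ∉ ({o} : Finset (Fin n)) ∧
            ∃ o' ∈ ({o} : Finset (Fin n)), s(o', y) ∈ ω)} = 0 := by
        rcases hy with rfl | hy0
        · exact (T_layer_empty_of_mem {y} N y hyN (Finset.mem_singleton_self y)).symm ▸ measureReal_empty
        · by_cases hyo : y = o
          · subst hyo
            exact (T_layer_empty_of_mem {y} N y hyN (Finset.mem_singleton_self y)).symm ▸ measureReal_empty
          · refine T_layer_null w {o} N y hyN (by simpa using hyo) fun v hv => ?_
            rw [Finset.mem_singleton.1 hv]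
            exact hy0
      rw [hw0, zero_mul]
    · -- all of `N` are fingers: apply FML3 in the star-killed weighting
      push Not at hbad
      refine mul_nonneg measureReal_nonneg ?_
      set K : Sym2 (Fin n) → unitInterval :=
        fun e' => if (∃ y ∈ e', y ∈ ({o} : Finset (Fin n))) then (0 : unitInterval) else w e' with hK
      have hfreeK : ∀ v ∈ N, ∀ y : Fin n, y ∉ A → y ∉ N → (K s(v, y) : ℝ) = 0 := by
        intro v hv y hyA hyN
        by_cases hoy : ∃ z ∈ s(v, y), z ∈ ({o} : Finset (Fin n))
        · simp only [hK, hoy, if_true]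
          rfl
        · simp only [hK, hoy, if_false]
          have hvo : v ≠ o := (hbad v hv).1
          have hyo : y ≠ o := fun h => hoy ⟨y, Sym2.mem_mk_right v y, Finset.mem_singleton.2 h⟩
          have hvA : v ∉ A := Finset.disjoint_left.1 hNA hv
          have hyv : y ≠ v := fun h => hyN (h ▸ hv)
          exact hfing v hvA hvo (hbad v hv).2 y hyA hyo hyv
      exact hT K N e hNA hNne he hfreeK hmin
  -- assemble: `T_e^{w}(o) ≥ 0`, then the additive inequality at level `t`
  have h1 : (prodBernoulli (fun e' : Sym2 (Fin n) =>
      if (∃ y ∈ e', y ∈ ({o} : Finset (Fin n))) then (0 : unitInterval) else w e')).real (openConn e b) ≤ 1 :=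
    measureReal_le_one
  have h2 : 0 ≤ (prodBernoulli (fun e' : Sym2 (Fin n) =>
          if (∀ y ∈ e', y ∈ ({o} : Finset (Fin n))) ∧ ¬ e'.IsDiag then 1 else w e')).real
          {ω : BondConfig (Fin n) | ∀ y : Fin n, y ∈ (∅ : Finset (Fin n)) ↔ (y ∉ ({o} : Finset (Fin n)) ∧
            ∃ o' ∈ ({o} : Finset (Fin n)), s(o', y) ∈ ω)} := measureReal_nonneg
  have hT : 0 ≤ (prodBernoulli (fun e' : Sym2 (Fin n) =>
          if (∀ y ∈ e', y ∈ ({o} : Finset (Fin n))) ∧ ¬ e'.IsDiag then 1 else w e')).real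
          (⋃ v ∈ ({o} : Finset (Fin n)), ⋃ a ∈ A, openConn v a)ᶜ +
        (prodBernoulli (fun e' : Sym2 (Fin n) =>
          if (∀ y ∈ e', y ∈ ({o} : Finset (Fin n))) ∧ ¬ e'.IsDiag then 1 else w e')).real
          (⋃ v ∈ ({o} : Finset (Fin n)), openConn v b) -
        (prodBernoulli (fun e' : Sym2 (Fin n) =>
          if (∀ y ∈ e', y ∈ ({o} : Finset (Fin n))) ∧ ¬ e'.IsDiag then 1 else w e')).real
          (openConn e b) := by
    nlinarith
  rw [goodStep24_glue_singleton w o] at hT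
  simp only [Finset.mem_singleton, Set.iUnion_iUnion_eq_left] at hT
  have hc : (prodBernoulli w).real (⋃ a ∈ A, openConn o a)ᶜ = 1 - (prodBernoulli w).real (⋃ a ∈ A, openConn o a) := by
    rw [measureReal_compl (MeasurableSet.of_discrete), probReal_univ]
  rw [hc] at hT
  have hAe := hA e he
  linarith


end FingersT

end

end Summit.CriticalPhenomena.PercolationContinuityZ3.Theorems
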